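import Summits.QuantumFields.BalabanUV.Beta.D1BFx.FineStencilBF
import Summits.QuantumFields.BalabanUV.Beta.D1BFx.RJetProjector
import Summits.QuantumFields.BalabanUV.Beta.D1BFx.RProjectorJet

/-!
# `BalabanUV.Beta.D1BFx.FineStencilBFBalaban` — road «BF-x» for binder row D1, sub-leaf T4-inst: the typer's BF first-order fine stencil
# `Sbf` (T4, `D1BFx/FineStencilBF`) INSTANTIATED at Bałaban's `U = 1` gauge term — `R := Rgt n a` (J5-asm), `Ṙ := Rdot n a cK cQ` (J5-kernel) —
# with EVERY socket binder discharged from landed theorems: `SbfBal n a cE cVH cΛ cR cK cQ` and its localisation / covariance /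
# transposition sockets and T8 plugs, hypotheses `0 < a` only

HONEST DEPENDENCY (page 1, mandatory): continuum YM on T⁴ ⇐ BetaPertH ∧ nine spine estimates (0/9 proved); BetaPertH ⇐ (D1) ∧ (D4) ∧
CAP+tail; G-an2-4 gates asym, D1 and NE2/3/4.  HONEST FRAMING (cell contract, verbatim): «discharging `BetaPertH` makes Bałaban's UV
stability UNCONDITIONAL — a real constructive-QFT result; it is NOT the continuum limit and NOT the Clay problem.»  THIS MODULE
DISCHARGES NOTHING of the wall: it composes LANDED road-BF-x scaffolding BY NAME — the typer's `FineStencilBF` (p212927: `Sbf`,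
`exists_biLoc_Sbf`, `Sbf_translate_block`, `Sbf_antisymm`, T8 plugs, `biLoc_anti`), leaf-07-g2's `RProjectorJet` (p212207: `Rdot`, `rdotOf`,
`biLoc_rdotOf`, `rdotOf_shiftK`, `biLoc_Jq`, `Jq_translate`, `cRdot`, `cV`, `cJ`), this seat's `RJetProjector` (p212764: `Rgt`, `decays_Rgt`,
`decays_Pgt`, `Rgt_symm`, `shiftK_Pgt`, `kerP_translate`, `decays_mono_rate`), the typer's `GhostLeg`/`GhostStencil` (`decays_Ggh`,
`shiftK_Ggh_neg`, `biLoc_Sgh`, `Sgh_translate`) — into ONE data definition and binder-free sockets.  Road scaffolding for ONE road to ONE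
conjunct (D1); 0 wall binders.  NOT D1, NOT `BetaPertH`, NOT continuum, NOT Clay.
ABSOLUTE RULE (cell charter, verbatim): «No internally-minted statement may enter as a cited fact. Every hypothesis is either
kernel-proved in this package or a verbatim quotation of a PUBLISHED theorem with page reference. The manuscript(s) under audit are NOT
citable for their own disputed steps — they are the thing under adjudication; programme-internal (2001/route/tribunal) claims are never
citable.»  Accordingly there is NO `def … : Prop` below, nothing is cited, and no hypothesis of any theorem is a printed statement.

RATE BOOKKEEPING (why §1 exists).  leaf-07-g2's `RProjectorJet.biLoc_Rdot` asks the projector's fine decay at the rate `dR a / n =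
min(δ_u, δ_P)/(4n)`; the sup-block bound of J5.0 (`RProjector.abs_Pgt_le`, rate `δ_PP = min(δ_P, δ_u)/2` per BLOCK in the sup metric)
converts to the fine `ℓ¹` rate `δ_PP/(4n) = min(δ_P, δ_u)/(8n)` (`RJetProjector.decays_Pgt`; the `4` = `ℓ¹ ≤ 4·sup` on `ℤ⁴`, sharp) — a factor
`2` short of that binder.  So §1 instantiates leaf-07-g2's GENERIC `biLoc_rdotOf` at the common rate `δ₀ := δ_PP/(4n)` (every leg weakened to
it) instead of using `biLoc_Rdot`: same object `Rdot`, same constant functional `cRdot`, rate `δ₀/8`, NO binder.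

CONTENT (`d = 4`; `n` = block side, `[NeZero n]`; `0 < a` the tower mass).
* §1 `rate0 n a := deltaPP 4 a / (4n)` and the J5-kernel binders DISCHARGED: **`biLoc_Rdot_bal`** (`BiLoc (Rdot n a cK cQ κ′ u) u u (cRdotBal …) (rate0 n a / 8)`),
  **`Rdot_translate_bal`** (`Rdot … κ′ (u + n•t) = shiftK (−(n•t)) (Rdot … κ′ u)`, from `shiftK_Pgt` + `kerP_translate`), `shiftK_Rgt_neg`.
* §2 [our object] **`SbfBal n a cE cVH cΛ cR cK cQ := Sbf n cE cVH cΛ cR (Rgt n a) (Rdot n a cK cQ)`**; **`exists_biLoc_SbfBal`** (`∃ Cs δ, 0 < δ ∧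
  ∀ κ′ u, BiLoc (SbfBal … κ′ u) u u Cs δ`), **`SbfBal_translate_block`**, **`SbfBal_antisymm`**; §3 the T8 plugs `exists_vertexFamily_vertexRed_SbfBal`,
  `vertexRed_SbfBal_translate`, `blockCovariant_vertexRed_SbfBal` (the last with the table-covariance binder `hW` of the consumer, as in T4).
NOT HERE: colour weights `cE cVH cΛ cR cK cQ` (REAL PARAMETERS, the owner's CHECK-N0 / RULING (iv)); the J6 sector of T4 v2; T5/T7/A-leaves.
Unit `b2b-balaban-beta-d1-formalise-leaf-05` (gen 3), D1 formalisation swarm; `LEAVES-BFx.md` sub-row T4-inst.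
-/

namespace Summit.QuantumFields.BalabanUV.Beta.D1BFx.FineStencilBFBalaban

open Literature.MathematicalPhysics.QuantumFieldTheory.Balaban1983to89
open Literature.MathematicalPhysics.QuantumFieldTheory.Balaban1983to89.Beta
open ExpKernelCalculus (Site MKer Decays BiLoc VertexFamily BlockCovariant shiftK)
open B6QGQDecay237 (deltaU deltaU_pos)
open Summit.QuantumFields.BalabanUV.Beta.TameKernelCalculus (decays_of_le)
open GhostLeg (Ggh decays_Ggh shiftK_Ggh_neg const_nonneg side_pred)
open GhostStencil (Sgh Sgh_translate biLoc_Sgh)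
open RProjector (Pgt kerP cPP deltaPP cPP_nonneg deltaPP_pos deltaP deltaP_pos)
open RProjectorJet (Rdot Rdot_def Rdot_antisymm rdotOf biLoc_rdotOf rdotOf_shiftK Jq biLoc_Jq Jq_translate cRdot cJ cJ_nonneg dJ)
open RJetProjector (Rgt Rgt_symm decays_Rgt decays_Pgt shiftK_Pgt kerP_translate decays_mono_rate)
open FineStencilBF (Sbf exists_biLoc_Sbf Sbf_translate_block Sbf_antisymm biLoc_anti exists_vertexFamily_vertexRed_Sbf
  vertexRed_Sbf_translate blockCovariant_vertexRed_Sbf)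
open ReducedKernel (vertexRed)
open GluonLeg (Ga)

noncomputable section

variable (n : ℕ) [NeZero n] (a : ℝ)

/-! ## §1 The J5-kernel binders discharged at the common rate `δ_PP/(4n)` -/

/-- [our object] THE COMMON FINE RATE `δ₀ = δ_PP/(4n)` at which all four legs of the site jet are localised. -/
def rate0 (n : ℕ) (a : ℝ) : ℝ := deltaPP 4 a / (4 * (n : ℝ))

/-- [folklore] `0 < δ₀`. -/
theorem rate0_pos (ha : 0 < a) : 0 < rate0 n a := by
  unfold rate0
  have := deltaPP_pos 4 ha
  have : (0 : ℝ) < n := Nat.cast_pos.mpr (Nat.pos_of_ne_zero (NeZero.ne n))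
  positivity

/-- [folklore] `δ_PP ≤ δ_u / 2` and `δ_PP ≤ δ_P / 2` (`δ_PP = min(δ_P, δ_u)/2`). -/
theorem deltaPP_le (a : ℝ) : deltaPP 4 a ≤ deltaU 4 a / 2 ∧ deltaPP 4 a ≤ deltaP 4 a / 2 := by
  unfold deltaPP
  constructor
  · have := min_le_right (deltaP 4 a) (deltaU 4 a); linarith
  · have := min_le_left (deltaP 4 a) (deltaU 4 a); linarith

/-- [our object] THE CONSTANT of the binder-free localisation of `Rdot` (leaf-07-g2's `cRdot` functional at the weakened legs). -/
def cRdotBal (n : ℕ) (a cK cQ : ℝ) : ℝ :=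
  cRdot (2 / min 2 a) (cPP 4 (n - 1) a * Real.exp (deltaPP 4 a))
    (|cK| * Real.exp (rate0 n a) + |cQ| * (8 / (n : ℝ) ^ 3 * Real.exp (8 * (deltaPP 4 a / 4)))) (cJ n a) (rate0 n a)

/-- [folklore] **THE SITE JET IS BI-LOCALISED AT ITS BOND, BINDER-FREE**: `BiLoc (Rdot n a cK cQ κ′ u) u u (cRdotBal n a cK cQ) (δ₀/8)` —
leaf-07-g2's generic `biLoc_rdotOf` with `G := Ggh` (`decays_Ggh`, rate weakened), `P := Pgt` (`RJetProjector.decays_Pgt`, rate `δ₀` on the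
nose), `V := Sgh` (`biLoc_Sgh` at `δ := δ_PP/4`), `J := Jq` (`biLoc_Jq`, rate weakened by `biLoc_anti`). -/
theorem biLoc_Rdot_bal (ha : 0 < a) (cK cQ : ℝ) (κ' : Fin 4) (u : Site 4) :
    BiLoc (Rdot n a cK cQ κ' u) u u (cRdotBal n a cK cQ) (rate0 n a / 8) := by
  have hn : (0 : ℝ) < n := Nat.cast_pos.mpr (Nat.pos_of_ne_zero (NeZero.ne n))
  have h0 := rate0_pos n a ha
  obtain ⟨hu, hp⟩ := deltaPP_le a
  have hδu := deltaU_pos 4 ha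
  have hδP := deltaP_pos 4 ha
  have hG : Decays (Ggh n a) (2 / min 2 a) (rate0 n a) := by
    have h := decays_of_le (decays_Ggh n a ha) (show rate0 n a ≤ deltaU 4 a / (4 * n) by
      unfold rate0; exact div_le_div_of_nonneg_right (by linarith) (by positivity))
    rwa [abs_of_nonneg (const_nonneg a ha)] at h
  have hP : Decays (Pgt n a) (cPP 4 (n - 1) a * Real.exp (deltaPP 4 a)) (rate0 n a) := decays_Pgt n a ha
  have hV : BiLoc (Sgh n cK cQ κ' u) u u
      (|cK| * Real.exp (rate0 n a) + |cQ| * (8 / (n : ℝ) ^ 3 * Real.exp (8 * (deltaPP 4 a / 4)))) (rate0 n a) := by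
    have h := biLoc_Sgh κ' u n cK cQ (show (0 : ℝ) ≤ deltaPP 4 a / 4 by have := deltaPP_pos 4 ha; positivity)
    have e : deltaPP 4 a / 4 / (n : ℝ) = rate0 n a := by unfold rate0; field_simp
    rwa [e] at h
  have hJ : BiLoc (Jq n a κ' u) u u (cJ n a) (rate0 n a) :=
    biLoc_anti (biLoc_Jq n a κ' u ha) (show rate0 n a ≤ dJ a / n by
      unfold rate0 dJ; rw [div_div]; exact div_le_div_of_nonneg_right (by linarith) (by positivity))
  rw [Rdot_def]
  exact biLoc_rdotOf hG hP hV hJ h0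

/-- [folklore] The packaged form: ONE constant, ONE positive rate, ALL bonds, NO binder. -/
theorem exists_biLoc_Rdot_bal (ha : 0 < a) (cK cQ : ℝ) :
    ∃ C δ : ℝ, 0 < δ ∧ ∀ (κ' : Fin 4) (u : Site 4), BiLoc (Rdot n a cK cQ κ' u) u u C δ :=
  ⟨cRdotBal n a cK cQ, rate0 n a / 8, by have := rate0_pos n a ha; positivity, fun κ' u => biLoc_Rdot_bal n a ha cK cQ κ' u⟩

/-- [folklore] `shiftK (−(n•t)) (Pgt n a) = Pgt n a` (the suppliers' sign; `RJetProjector.shiftK_Pgt` at `−t`). -/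
theorem shiftK_Pgt_neg (ha : 0 < a) (t : Site 4) : shiftK (-((n : ℤ) • t)) (Pgt n a) = Pgt n a := by
  rw [← smul_neg]; exact shiftK_Pgt n ha (-t)

/-- [folklore] `shiftK (−(n•t)) (Rgt n a) = Rgt n a` — the `hRt` binder of T4's `Sbf_translate_block` for `R := Rgt n a`. -/
theorem shiftK_Rgt_neg (ha : 0 < a) (t : Site 4) : shiftK (-((n : ℤ) • t)) (Rgt n a) = Rgt n a := by
  rw [← smul_neg]; exact RJetProjector.shiftK_Rgt n ha (-t)

/-- [folklore] `kerP` in the road's currency is block-covariant (`RJetProjector.kerP_translate` at block side `n = side (n−1)`). -/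
theorem kerP_translate_road (ha : 0 < a) (q y t : Site 4) :
    kerP (d := 4) (n - 1) a (q + (n : ℤ) • t) (y + t) = kerP (d := 4) (n - 1) a q y := by
  have h := kerP_translate (n - 1) ha t q y
  rwa [side_pred] at h

/-- [folklore] **THE SITE JET IS BLOCK-COVARIANT, BINDER-FREE**: `Rdot n a cK cQ κ′ (u + n•t) = shiftK (−(n•t)) (Rdot n a cK cQ κ′ u)` —
leaf-07-g2's `Rdot_translate` with `hPs := shiftK_Pgt_neg`, `hkerP := kerP_translate_road`. -/
theorem Rdot_translate_bal (ha : 0 < a) (cK cQ : ℝ) (κ' : Fin 4) (u t : Site 4) :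
    Rdot n a cK cQ κ' (u + (n : ℤ) • t) = shiftK (-((n : ℤ) • t)) (Rdot n a cK cQ κ' u) :=
  RProjectorJet.Rdot_translate n a cK cQ κ' u ha (shiftK_Pgt_neg n a ha) (kerP_translate_road n a ha) t

/-! ## §2 T4 at Bałaban's gauge term: `SbfBal` and its binder-free sockets -/

/-- [our object] **THE BF FIRST-ORDER FINE STENCIL AT BAŁABAN'S `U = 1` GAUGE TERM**:
`SbfBal n a cE cVH cΛ cR cK cQ := Sbf n cE cVH cΛ cR (Rgt n a) (Rdot n a cK cQ)` — the typer's T4 with the J5 objects plugged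
(`R = 1 − Pgt n a`, `Ṙ = Rdot n a cK cQ`).  Colour weights are REAL PARAMETERS; a definition asserting nothing. -/
def SbfBal (cE cVH cΛ cR cK cQ : ℝ) : Fin 4 → Site 4 → MKer 4 (Fin 4) :=
  Sbf n cE cVH cΛ cR (Rgt n a) (Rdot n a cK cQ)

/-- [our object] Unfolding `SbfBal`. -/
theorem SbfBal_def (cE cVH cΛ cR cK cQ : ℝ) : SbfBal n a cE cVH cΛ cR cK cQ = Sbf n cE cVH cΛ cR (Rgt n a) (Rdot n a cK cQ) := rfl

/-- [folklore] **SOCKET 1, BINDER-FREE**: `SbfBal` is a bi-localised stencil family at SOME positive rate —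
`∃ Cs δ, 0 < δ ∧ ∀ κ′ u, BiLoc (SbfBal … κ′ u) u u Cs δ` (T4's `exists_biLoc_Sbf` with `decays_Rgt` weakened to `δ₀/8` and `biLoc_Rdot_bal`). -/
theorem exists_biLoc_SbfBal (ha : 0 < a) (cE cVH cΛ cR cK cQ : ℝ) :
    ∃ Cs δ : ℝ, 0 < δ ∧ ∀ (κ' : Fin 4) (u : Site 4), BiLoc (SbfBal n a cE cVH cΛ cR cK cQ κ' u) u u Cs δ := by
  have h0 := rate0_pos n a ha
  have hC : 0 ≤ 1 + cPP 4 (n - 1) a * Real.exp (deltaPP 4 a) := by have := cPP_nonneg 4 (n - 1) ha; positivity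
  have hR : Decays (Rgt n a) (1 + cPP 4 (n - 1) a * Real.exp (deltaPP 4 a)) (rate0 n a / 8) :=
    decays_mono_rate (decays_Rgt n a ha) hC (by unfold rate0 at h0 ⊢; linarith)
  obtain ⟨Cs, δ, hδ, -, h⟩ := exists_biLoc_Sbf (NeZero.one_le (n := n)) cE cVH cΛ cR (by positivity) hR
    (fun κ' u => biLoc_Rdot_bal n a ha cK cQ κ' u)
  exact ⟨Cs, δ, hδ, h⟩

/-- [folklore] **SOCKET 2, BINDER-FREE**: block covariance `SbfBal … κ′ (u + n•t) = shiftK (−(n•t)) (SbfBal … κ′ u)`. -/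
theorem SbfBal_translate_block (ha : 0 < a) (cE cVH cΛ cR cK cQ : ℝ) (κ' : Fin 4) (u t : Site 4) :
    SbfBal n a cE cVH cΛ cR cK cQ κ' (u + (n : ℤ) • t) = shiftK (-((n : ℤ) • t)) (SbfBal n a cE cVH cΛ cR cK cQ κ' u) :=
  Sbf_translate_block (NeZero.one_le (n := n)) cE cVH cΛ cR (shiftK_Rgt_neg n a ha) (fun κ'' u' t' => Rdot_translate_bal n a ha cK cQ κ'' u' t')
    κ' u t

/-- [folklore] **SOCKET 3, BINDER-FREE**: antisymmetry `SbfBal … κ′ u z x β α = −SbfBal … κ′ u x z α β` (`Rgt` symmetric, `Rdot` antisymmetric). -/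
theorem SbfBal_antisymm (ha : 0 < a) (cE cVH cΛ cR cK cQ : ℝ) (κ' : Fin 4) (u x z : Site 4) (α β : Fin 4) :
    SbfBal n a cE cVH cΛ cR cK cQ κ' u z x β α = -SbfBal n a cE cVH cΛ cR cK cQ κ' u x z α β :=
  Sbf_antisymm cE cVH cΛ cR (Rgt_symm n a ha) (fun κ'' u' x' z' => Rdot_antisymm n a cK cQ κ'' u' x' z' () ()) κ' u x z α β

/-! ## §3 The T8 plugs at the instance -/

/-- [folklore] **T8 PLUG 1, BINDER-FREE**: the reduced vertex family of `SbfBal` is a `VertexFamily` at some positive rate. -/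
theorem exists_vertexFamily_vertexRed_SbfBal (ha : 0 < a) (cE cVH cΛ cR cK cQ : ℝ) :
    ∃ Cv δv : ℝ, 0 < δv ∧ VertexFamily (vertexRed n (SbfBal n a cE cVH cΛ cR cK cQ)) n Cv δv := by
  have h0 := rate0_pos n a ha
  have hC : 0 ≤ 1 + cPP 4 (n - 1) a * Real.exp (deltaPP 4 a) := by have := cPP_nonneg 4 (n - 1) ha; positivity
  have hR : Decays (Rgt n a) (1 + cPP 4 (n - 1) a * Real.exp (deltaPP 4 a)) (rate0 n a / 8) :=
    decays_mono_rate (decays_Rgt n a ha) hC (by unfold rate0 at h0 ⊢; linarith)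
  exact exists_vertexFamily_vertexRed_Sbf (NeZero.one_le (n := n)) cE cVH cΛ cR (by positivity) hR (fun κ' u => biLoc_Rdot_bal n a ha cK cQ κ' u)

/-- [folklore] **T8 PLUG 2, BINDER-FREE**: block covariance of the reduced vertex of `SbfBal`. -/
theorem vertexRed_SbfBal_translate (ha : 0 < a) (cE cVH cΛ cR cK cQ : ℝ) (μ : Fin 4) (y t : Site 4) :
    vertexRed n (SbfBal n a cE cVH cΛ cR cK cQ) μ (y + t) = shiftK (-((n : ℤ) • t)) (vertexRed n (SbfBal n a cE cVH cΛ cR cK cQ) μ y) :=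
  vertexRed_Sbf_translate (NeZero.one_le (n := n)) cE cVH cΛ cR (shiftK_Rgt_neg n a ha) (fun κ'' u' t' => Rdot_translate_bal n a ha cK cQ κ'' u' t')
    μ y t

/-- [folklore] **T8 PLUG 3**: `BlockCovariant (Ga n a) (vertexRed n (SbfBal …)) W n` for any block-covariant table `W` (binder `hW` is the
consumer's table, as in T4). -/
theorem blockCovariant_vertexRed_SbfBal (ha : 0 < a) (cE cVH cΛ cR cK cQ : ℝ)
    {W : Fin 4 → Site 4 → Fin 4 → Site 4 → MKer 4 (Fin 4)}
    (hW : ∀ (μ : Fin 4) (y : Site 4) (ν : Fin 4) (y' t : Site 4), W μ (y + t) ν (y' + t) = shiftK (-((n : ℤ) • t)) (W μ y ν y')) :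
    BlockCovariant (Ga n a) (vertexRed n (SbfBal n a cE cVH cΛ cR cK cQ)) W n :=
  blockCovariant_vertexRed_Sbf (NeZero.one_le (n := n)) a cE cVH cΛ cR (shiftK_Rgt_neg n a ha)
    (fun κ'' u' t' => Rdot_translate_bal n a ha cK cQ κ'' u' t') hW

end

end Summit.QuantumFields.BalabanUV.Beta.D1BFx.FineStencilBFBalaban
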